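import Literature.Computability.Complexity.TC0SubsetNC1Reduction
import HarnessLib

/-!
# Bounded fan-in threshold circuits, I: the calculus over `tcBnd A`

Helper file (1/3) for the stub `stub_polyWires` of the line `Sketch` of the crux `CircuitNpTc0`
(`¬ (NP ⊆ TC0)`): weight normalisation of `TC⁰` circuits (every constant-depth circuit over
`tcBasis` with `s` gates on `n` inputs is equivalent to one of constant depth with polynomially
many WIRES).

The tree's realizability calculus `ACRealOver B f d s` / `ACVecOver B f d s`
(`ACRealizeOver.lean`, `ACVecOver.lean`) records basis, depth and NUMBER OF GATES of a circuit,
but not its number of wires (sum of arities). We obtain wire bounds for free by working over the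
restricted basis `tcBnd A = {g ∈ tcBasis | arity g ≤ A}`: a circuit over `tcBnd A` with `S`
gates has at most `S · A` wires (`wires_le_of_fanIn`). This file re-derives over an arbitrary
basis `B ⊇ tcBnd A` (hypothesis `hB : ∀ g ∈ tcBasis, g.1 ≤ A → g ∈ B`) the generic blocks of
the calculus (`∧`/`∨` of a finite family, constants, `⊕`, `∨` of `∧`s of two wires) and the
threshold gadgets of `ThresholdGadgets.lean` (one padded majority gate, weighted threshold
`[θ ≤ ∑ c·y]`, exact value `[∑ c·y = v]`), each under the hypothesis that the fan-in it uses is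
`≤ A`. All proofs are those of the tree files with the basis membership replaced.

## References

* H. Vollmer, *Introduction to Circuit Complexity* (1999), §1.2 (composition, depth), §1.4.1,
  proof of Thm. 1.37 (thresholds from padded majority gates; exact values) [Vollmer1999].
-/

-- `Summit.<Summit>.<Problem>`: for the single-conjunct summit `PneNP` the duplicate `PneNP.PneNP` is mandated (D-0017).
set_option linter.dupNamespace false

namespace Summit.PneNP.PneNP.Cruxes.CircuitNpTc0.Sketch

open Literature.Computability.Complexity Finset GateList

variable {B : Set GateFn}

variable {ι α : Type*}

/-! ### Bases containing the `TC` gates of fan-in `≤ A` -/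

/-- `∧ₖ ∈ B` for `k ≤ A`. [folklore] -/
theorem and_mem_of {A k : ℕ} (hB : ∀ g ∈ tcBasis, g.1 ≤ A → g ∈ B) (h : k ≤ A) : GateFn.and k ∈ B :=
  hB _ (acBasis_subset_tcBasis (and_mem_acBasis k)) h

/-- `∨ₖ ∈ B` for `k ≤ A`. [folklore] -/
theorem or_mem_of {A k : ℕ} (hB : ∀ g ∈ tcBasis, g.1 ≤ A → g ∈ B) (h : k ≤ A) : GateFn.or k ∈ B :=
  hB _ (acBasis_subset_tcBasis (or_mem_acBasis k)) h

/-- `MAJₖ ∈ B` for `k ≤ A`. [folklore] -/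
theorem maj_mem_of {A k : ℕ} (hB : ∀ g ∈ tcBasis, g.1 ≤ A → g ∈ B) (h : k ≤ A) : GateFn.maj k ∈ B :=
  hB _ (maj_mem_tcBasis k) h

/-- `¬ ∈ B` for `1 ≤ A`. [folklore] -/
theorem not_mem_of {A : ℕ} (hB : ∀ g ∈ tcBasis, g.1 ≤ A → g ∈ B) (h : 1 ≤ A) : GateFn.not ∈ B :=
  hB _ not_mem_tcBasis h

/-- **Wires from gates**: a circuit over the gates of `tcBasis` of fan-in `≤ A` with `S` gates has
at most `S · A` wires (sum of the arities of its gates). [folklore] -/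
theorem wires_le_of_fanIn {A : ℕ} (C : Circuit ι)
    (h : C.IsOver {g : GateFn | g ∈ tcBasis ∧ g.1 ≤ A}) :
    (C.gates.map Gate.arity).sum ≤ C.size * A := by
  have h1 := List.sum_le_card_nsmul (C.gates.map Gate.arity) A (fun x hx => by
    obtain ⟨g, hg, rfl⟩ := List.mem_map.1 hx
    exact (h g hg).2)
  simpa [Circuit.size] using h1

/-! ### Generic blocks over `B ⊇ tcBnd A` -/

/-- Unbounded fan-in conjunction of `M ≤ A` realized functions. [cite: Vollmer1999, §1.2] -/
theorem bnd_forall {A M : ℕ}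
    (hB : ∀ g ∈ tcBasis, g.1 ≤ A → g ∈ B) (hM : M ≤ A) {f : Fin M → (ι → Bool) → Bool} {d : ℕ}
    {s : Fin M → ℕ} (h : ∀ j, ACRealOver B (f j) d (s j)) :
    ACRealOver B (fun x => decide (∀ j, f j x = true)) (d + 1) (∑ j, s j + 1) :=
  acRealOver_gate (GateFn.and M) (and_mem_of hB hM) h

/-- Unbounded fan-in disjunction of `M ≤ A` realized functions. [cite: Vollmer1999, §1.2] -/
theorem bnd_exists {A M : ℕ}
    (hB : ∀ g ∈ tcBasis, g.1 ≤ A → g ∈ B) (hM : M ≤ A) {f : Fin M → (ι → Bool) → Bool} {d : ℕ}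
    {s : Fin M → ℕ} (h : ∀ j, ACRealOver B (f j) d (s j)) :
    ACRealOver B (fun x => decide (∃ j, f j x = true)) (d + 1) (∑ j, s j + 1) :=
  acRealOver_gate (GateFn.or M) (or_mem_of hB hM) h

/-- Conjunction with a uniform size bound. [cite: Vollmer1999, §1.2] -/
theorem bnd_forall_const {A M : ℕ}
    (hB : ∀ g ∈ tcBasis, g.1 ≤ A → g ∈ B) (hM : M ≤ A) {f : Fin M → (ι → Bool) → Bool} {d s : ℕ}
    (h : ∀ j, ACRealOver B (f j) d s) :
    ACRealOver B (fun x => decide (∀ j, f j x = true)) (d + 1) (M * s + 1) :=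
  (bnd_forall hB hM h).mono le_rfl (by simp)

/-- Disjunction with a uniform size bound. [cite: Vollmer1999, §1.2] -/
theorem bnd_exists_const {A M : ℕ}
    (hB : ∀ g ∈ tcBasis, g.1 ≤ A → g ∈ B) (hM : M ≤ A) {f : Fin M → (ι → Bool) → Bool} {d s : ℕ}
    (h : ∀ j, ACRealOver B (f j) d s) :
    ACRealOver B (fun x => decide (∃ j, f j x = true)) (d + 1) (M * s + 1) :=
  (bnd_exists hB hM h).mono le_rfl (by simp)

/-- Conjunction over a finite index type of cardinality `≤ A`. [cite: Vollmer1999, §1.2] -/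
theorem bnd_forall_fintype {A : ℕ}
    (hB : ∀ g ∈ tcBasis, g.1 ≤ A → g ∈ B) {κ : Type*} [Fintype κ] (hκ : Fintype.card κ ≤ A)
    {f : κ → (ι → Bool) → Bool} {d s : ℕ} (h : ∀ k, ACRealOver B (f k) d s) :
    ACRealOver B (fun x => decide (∀ k, f k x = true)) (d + 1) (Fintype.card κ * s + 1) := by
  have h' : ∀ j : Fin (Fintype.card κ), ACRealOver B (f ((Fintype.equivFin κ).symm j)) d s :=
    fun j => h _
  refine (bnd_forall_const hB hκ h').congr fun x => ?_
  simp only [decide_eq_decide]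
  exact ⟨fun H k => by simpa using H (Fintype.equivFin κ k), fun H j => H _⟩

/-- Disjunction over a finite index type of cardinality `≤ A`. [cite: Vollmer1999, §1.2] -/
theorem bnd_exists_fintype {A : ℕ}
    (hB : ∀ g ∈ tcBasis, g.1 ≤ A → g ∈ B) {κ : Type*} [Fintype κ] (hκ : Fintype.card κ ≤ A)
    {f : κ → (ι → Bool) → Bool} {d s : ℕ} (h : ∀ k, ACRealOver B (f k) d s) :
    ACRealOver B (fun x => decide (∃ k, f k x = true)) (d + 1) (Fintype.card κ * s + 1) := by
  have h' : ∀ j : Fin (Fintype.card κ), ACRealOver B (f ((Fintype.equivFin κ).symm j)) d s :=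
    fun j => h _
  refine (bnd_exists_const hB hκ h').congr fun x => ?_
  simp only [decide_eq_decide]
  exact ⟨fun ⟨j, hj⟩ => ⟨_, hj⟩, fun ⟨k, hk⟩ => ⟨Fintype.equivFin κ k, by simpa using hk⟩⟩

/-- Constants over `B ⊇ tcBnd A` (the gates `∧₀ = true`, `∨₀ = false` of fan-in `0`): depth `1`,
one gate. [cite: Vollmer1999, §1.2] -/
theorem bnd_const {A : ℕ}
    (hB : ∀ g ∈ tcBasis, g.1 ≤ A → g ∈ B) (b : Bool) :
    ACRealOver B (fun _ : ι → Bool => b) 1 1 := by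
  cases b
  · have h := bnd_exists (ι := ι) hB (Nat.zero_le A) (f := fun (_ : Fin 0) (_ : ι → Bool) => false)
      (d := 0) (s := fun _ => 0) (fun j => j.elim0)
    refine (h.congr fun x => ?_).mono le_rfl (by simp)
    simp
  · have h := bnd_forall (ι := ι) hB (Nat.zero_le A) (f := fun (_ : Fin 0) (_ : ι → Bool) => false)
      (d := 0) (s := fun _ => 0) (fun j => j.elim0)
    refine (h.congr fun x => ?_).mono le_rfl (by simp)
    simp

/-- **An `∨` of `∧`s of two wires** over `B ⊇ tcBnd A`: `[∃ v, z (a v) ∧ z (b v)]` at depth `2` with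
`card V + 1` gates (fan-ins `card V` and `2`). [cite: Vollmer1999, §1.2] -/
theorem bnd_exists_and₂ {A : ℕ}
    (hB : ∀ g ∈ tcBasis, g.1 ≤ A → g ∈ B) (h2 : 2 ≤ A) {V : Type*} [Fintype V]
    (hV : Fintype.card V ≤ A) (a b : V → ι) :
    ACRealOver B (fun z : ι → Bool => decide (∃ v, z (a v) = true ∧ z (b v) = true)) 2
      (Fintype.card V * 1 + 1) := by
  have hblk : ∀ v, ACRealOver B
      (fun z : ι → Bool => decide (∀ k : Fin 2, ![z (a v), z (b v)] k = true)) 1 (2 * 0 + 1) :=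
    fun v =>
    bnd_forall_const hB h2 (f := fun (k : Fin 2) (z : ι → Bool) => ![z (a v), z (b v)] k)
      fun k => by
        fin_cases k
        · exact acRealOver_input B (a v)
        · exact acRealOver_input B (b v)
  refine (bnd_exists_fintype hB hV hblk).congr fun z => ?_
  simp [Fin.forall_fin_two]

/-- **Exclusive or** of two realized functions over `B ⊇ tcBnd A` (`2 ≤ A`): depth `+ 2`, via
`(f ∧ ¬g) ∨ (¬f ∧ g)`. [cite: Vollmer1999, §1.2] -/
theorem bnd_xor {A : ℕ}
    (hB : ∀ g ∈ tcBasis, g.1 ≤ A → g ∈ B) (h2 : 2 ≤ A) {f g : (ι → Bool) → Bool} {d s : ℕ}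
    (hf : ACRealOver B f d s) (hg : ACRealOver B g d s) :
    ACRealOver B (fun x => (f x ^^ g x)) (d + 2) (2 * (2 * (s + 1) + 1) + 1) := by
  have hnot : GateFn.not ∈ B := not_mem_of hB (by omega)
  have lf : ACRealOver B f d (s + 1) := hf.mono le_rfl (Nat.le_succ _)
  have lg : ACRealOver B g d (s + 1) := hg.mono le_rfl (Nat.le_succ _)
  have nf : ACRealOver B (fun x => !f x) d (s + 1) := hf.neg hnot
  have ng : ACRealOver B (fun x => !g x) d (s + 1) := hg.neg hnot
  have c1 : ACRealOver B (fun x => decide (∀ k : Fin 2, ![f x, !g x] k = true)) (d + 1)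
      (2 * (s + 1) + 1) :=
    bnd_forall_const hB h2 (f := fun (k : Fin 2) x => ![f x, !g x] k) fun k => by
      fin_cases k
      · exact lf
      · exact ng
  have c2 : ACRealOver B (fun x => decide (∀ k : Fin 2, ![!f x, g x] k = true)) (d + 1)
      (2 * (s + 1) + 1) :=
    bnd_forall_const hB h2 (f := fun (k : Fin 2) x => ![!f x, g x] k) fun k => by
      fin_cases k
      · exact nf
      · exact lg
  have h := bnd_exists_const hB h2
    (f := fun (k : Fin 2) x => ![decide (∀ k : Fin 2, ![f x, !g x] k = true),
      decide (∀ k : Fin 2, ![!f x, g x] k = true)] k) (fun k => by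
      fin_cases k
      · exact c1
      · exact c2)
  refine h.congr fun x => ?_
  cases f x <;> cases g x <;> simp [Fin.exists_fin_two, Fin.forall_fin_two]

/-! ### Threshold gadgets over `B ⊇ tcBnd A` -/

section Wsum

variable [Fintype α]

/-- **One padded majority gate** over `B ⊇ tcBnd A`: `[∑ c + pad ≤ 2 · (∑ₐ cₐ[yₐ] + pad·[b])]` at
depth `2` with `∑ c + pad + 1` gates, provided the fan-in `∑ c + pad` is `≤ A`.
[cite: Vollmer1999, §1.4.1, proof of Thm. 1.37] -/
theorem bnd_majPad {A : ℕ}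
    (hB : ∀ g ∈ tcBasis, g.1 ≤ A → g ∈ B) (c : α → ℕ) (pad : ℕ) (b : Bool)
    (hA : (∑ a, c a) + pad ≤ A) :
    ACRealOver B
      (fun y : α → Bool => decide ((∑ a, c a) + pad ≤ 2 * (wsum c y + pad * b.toNat))) 2
      ((∑ a, c a) + pad + 1) := by
  classical
  set k := Fintype.card (MajSlots c pad) with hk
  have hkval : k = (∑ a, c a) + pad := by
    rw [hk, Fintype.card_sum, Fintype.card_sigma]
    simp
  set e := Fintype.equivFin (MajSlots c pad) with he
  -- the argument blocks
  let f : Fin k → (α → Bool) → Bool := fun j => slotFn c pad b (e.symm j)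
  have hf : ∀ j, ACRealOver B (f j) 1 1 := by
    intro j
    change ACRealOver B (slotFn c pad b (e.symm j)) 1 1
    cases e.symm j with
    | inl σ => exact (acRealOver_input B σ.1).mono zero_le_one zero_le_one
    | inr _ => exact bnd_const hB b
  have hg := acRealOver_gate (GateFn.maj k) (maj_mem_of hB (by rw [hkval]; exact hA))
    (s := fun _ => 1) hf
  simp only [Finset.sum_const, Finset.card_univ, Fintype.card_fin, smul_eq_mul, mul_one] at hg
  refine (hg.congr fun y => ?_).mono le_rfl (by rw [hkval]; exact le_rfl)
  -- semantics of the majority gate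
  change decide (k ≤ 2 * GateFn.numOnes fun j => f j y) = _
  have hcount : GateFn.numOnes (fun j => f j y) = wsum c y + pad * b.toNat := by
    unfold GateFn.numOnes
    have h1 : #{j : Fin k | f j y = true} = #{w : MajSlots c pad | slotFn c pad b w y = true} := by
      refine Finset.card_equiv e.symm fun j => ?_
      simp [f]
    rw [h1, Finset.card_filter, ← sum_slotFn_toNat c pad b y]
    refine Finset.sum_congr rfl fun w _ => ?_
    cases slotFn c pad b w y <;> simp
  rw [hcount, hkval]

/-- **Weighted threshold by one majority gate** over `B ⊇ tcBnd A`: `[θ ≤ ∑ₐ cₐ·yₐ]` at depth `2`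
with at most `2(∑ c + θ) + 2` gates, provided `2(∑ c + θ) + 2 ≤ A` (a bound for the fan-in of the
padded gate). [cite: Vollmer1999, §1.4.1, proof of Thm. 1.37] -/
theorem bnd_wsum_ge {A : ℕ}
    (hB : ∀ g ∈ tcBasis, g.1 ≤ A → g ∈ B) (c : α → ℕ) (θ : ℕ) (hA : 2 * ((∑ a, c a) + θ) + 2 ≤ A) :
    ACRealOver B (fun y : α → Bool => decide (θ ≤ wsum c y)) 2 (2 * ((∑ a, c a) + θ) + 2) := by
  set C := ∑ a, c a with hC
  rcases Nat.eq_zero_or_pos θ with rfl | hθ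
  · refine ((bnd_const hB true).congr fun y => ?_).mono one_le_two (by omega)
    simp
  by_cases hcase : C + 1 ≤ 2 * θ
  · -- pad with `2θ - 1 - C` zeros
    have h := bnd_majPad hB c (2 * θ - 1 - C) false (by omega)
    refine (h.congr fun y => ?_).mono le_rfl (by omega)
    simp only [Bool.toNat_false, mul_zero, add_zero, decide_eq_decide]
    rw [← hC]
    omega
  · -- pad with `C + 1 - 2θ` ones
    have h := bnd_majPad hB c (C + 1 - 2 * θ) true (by omega)
    refine (h.congr fun y => ?_).mono le_rfl (by omega)
    simp only [Bool.toNat_true, mul_one, decide_eq_decide]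
    rw [← hC]
    omega

/-- **Exact value of a weighted sum** over `B ⊇ tcBnd A`: `[∑ₐ cₐ·yₐ = v]` at depth `3` with at most
`4(∑ c + v) + 11` gates (`[≥ v] ∧ ¬[≥ v+1]`), provided `4(∑ c + v) + 11 ≤ A`.
[cite: Vollmer1999, §1.4.1, proof of Thm. 1.37] -/
theorem bnd_wsum_eq {A : ℕ}
    (hB : ∀ g ∈ tcBasis, g.1 ≤ A → g ∈ B) (c : α → ℕ) (v : ℕ) (hA : 4 * ((∑ a, c a) + v) + 11 ≤ A) :
    ACRealOver B (fun y : α → Bool => decide (wsum c y = v)) 3 (4 * ((∑ a, c a) + v) + 11) := by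
  have h1 : ACRealOver B (fun y : α → Bool => decide (v ≤ wsum c y)) 2
      (2 * ((∑ a, c a) + v + 1) + 3) :=
    (bnd_wsum_ge hB c v (by omega)).mono le_rfl (by omega)
  have h2 : ACRealOver B (fun y : α → Bool => !decide (v + 1 ≤ wsum c y)) 2
      (2 * ((∑ a, c a) + v + 1) + 3) :=
    ((bnd_wsum_ge hB c (v + 1) (by omega)).neg (not_mem_of hB (by omega))).mono le_rfl (by omega)
  let fam : Fin 2 → (α → Bool) → Bool :=
    Fin.cons (fun y => decide (v ≤ wsum c y)) (fun _ y => !decide (v + 1 ≤ wsum c y))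
  have hfam : ∀ j, ACRealOver B (fam j) 2 (2 * ((∑ a, c a) + v + 1) + 3) := by
    intro j
    refine Fin.cases ?_ (fun j => ?_) j
    · simpa [fam] using h1
    · fin_cases j; simpa [fam] using h2
  refine ((bnd_forall_const hB (by omega) hfam).congr fun y => ?_).mono le_rfl (by omega)
  have key : (∀ j, fam j y = true) ↔ wsum c y = v := by
    simp only [Fin.forall_fin_two]
    simp only [fam, Fin.cons_zero, Fin.cons_one, decide_eq_true_eq, Bool.not_eq_true',
      decide_eq_false_iff_not, not_le]
    omega
  exact decide_eq_decide.2 key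

end Wsum


end Summit.PneNP.PneNP.Cruxes.CircuitNpTc0.Sketch
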